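/-
Copyright (c) 2026 the pub-hodgecm-mathlib formalisation cell (harness21).  Prover seat hodgecm-mathlib-F0P3-p01 (g31), «(D-RAM) FOUR-FRAME» road of crux H413, line LH4, MS ROAD A,
STAGE B (LH4-p10 (g2) SPEC-StageB v2-B5split §B5 (iii)), brick B5 (iii) «GLUED STABILISER INDEX», FILE 2 of 2: the index.  2026-09-04.
-/
import Summits.HodgeConjecture.HodgeConjecture.Theorems.F0P3cDyRamDiagonalGluedFixedStabiliser   -- FILE 1 (this seat): membership (b) ∧ (c′), lineariser, level groups, ratio map; brings ★ DEFS LEAF `F0P3cDyRamDiagonalTorusDefs`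
import Literature.NumberTheory.LocalFields.RamifiedQuadraticResidueCountsUnits                       -- ★ p855694 B1 FILE 2 (F0P3-p01 (g30)): `relIndex_fixedUnitLevel_eq` ((C4) `[U_F : U_{F,n}] = (q−1)q^{⌈n∕2⌉−1}`)
import Literature.NumberTheory.Automorphic.UnitaryLatticeTreeTubeCoordinate                           -- ★ `v_pow_eq_exp_neg` (`|ϖ|^n = exp(−n)`)
import Mathlib.GroupTheory.QuotientGroup.Basic
import HarnessLib

/-!
# Crux `H413`, MS ROAD A, STAGE B brick B5 (iii) «GLUED STABILISER INDEX», FILE 2: `[𝒰 : S_F(M)] = (q−1)q^{⌈(ρ+s)∕2⌉−1} · (q−1)q^{ρ−1}` on the glued strata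

Cell `hodgecm-mathlib` (D-0151), FLOOR 0, crux item H413 = `stmt-HodgeConjecture-24833`; lane `--supports stmt-HodgeConjecture-24833 --as helper` (count-neutral).  THEOREMS ONLY
(no `def`, no instance, no notation, no `sorry`).  LH4-p10 (g2) SPEC-StageB v2-B5split §B5 (iii) (`F0/P3c/LH4/LH4-p10/g2/SPEC-StageB.v2-B5split.LH4p10g2.md` a6778cd80cb70dec;
MEMO v2 §4 «STABILISER» (3)–(4)).

THE SETTING.  As in FILE 1, now over a RAMIFIED QUADRATIC DATUM in the letters of ★ B0∕B1: `σ` an involution, `|σ·| = |·|`, `|ϖ| = exp(−1)`, `hfix` (fixed elements have even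
valuation), `hd`; `[Finite 𝓀[K]]`, `q := Nat.card 𝓀[K]`; no completeness.  `𝒰 = fixedUnitTorus σ 3`, `S_F(M) = fixedUnitStabilizer σ M`, the glued frame
`V = (1 0 0; x ϖ^ρ 0; xζ + y″  ϖ^ρζ  ϖ^{2ρ+s})` (`|x| = |ζ| = 1`, `|y″| = |ϖ|^s`, `ρ ≥ 1`), criterion (R) `∃ f = σf, |ζσy″ − σx·f| ≤ |ϖ|^{ρ+s}` (★ B5 (i) p855737).

WHAT IS PROVED — THE TWO-STEP INDEX (MEMO v2 §4 «STABILISER»).  `S_F ≤ S₁ := {u ∈ 𝒰 | u₁∕u₂ ∈ U_{ρ+s}} ≤ 𝒰`.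
* §5 `relIndex_ratioLevel_fixedUnitTorus_eq`: `[𝒰 : S₁] = [U_F : U_{F,n}] = (q−1)q^{(n+1)∕2−1}` (`Subgroup.relIndex_comap` along `u ↦ u₁∕u₂`, onto `U_F` by FILE 1, then ★ B1 (C4));
  `relIndex_fixedUnitStabilizer_ratioLevel_eq`: `[S₁ : S_F] = [U_F : U_{F,2ρ}] = (q−1)q^{ρ−1}` via the TWISTED HOMOMORPHISM `Θ : S₁ → K^×∕U_{2ρ}`,
  `u ↦ (u₀∕u₂)·(1 + g(1 − u₁∕u₂))⁻¹` (a homomorphism by FILE 1's defect lemma, kernel `S_F` by FILE 1's (b) ∧ (c′) description, image `U_F·U_{2ρ}∕U_{2ρ}` — onto by `u = (w,1,1)` —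
  of cardinality `[U_F : U_{F,2ρ}]` by `Subgroup.index_ker` ∕ `relIndex_ker` and ★ B1 (C4) with `(2ρ+1)∕2 − 1 = ρ − 1`).
* §6 HEADS: `relIndex_fixedUnitStabilizer_latt_glued_eq_of_lineariser` (product by `Subgroup.relIndex_mul_relIndex`), **`relIndex_fixedUnitStabilizer_latt_glued_eq`** (general second
  exponent `s`, under (R), lineariser `g = ζσζ∕f` from FILE 1), `stabiliserWeight_latt_glued_eq` (`= ([𝒰 : S_F])⁻¹` in `ℚ`, ★ DEFS LEAF), and the B5 (iii) letters `s = 2t` of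
  ★ B5 (i): **`relIndex_fixedUnitStabilizer_latt_glued_tube_eq`**, `stabiliserWeight_latt_glued_tube_eq` (`= ((q−1)q^{(ρ+2t+1)∕2−1}·(q−1)q^{ρ−1})⁻¹ = ((q−1)²q^{⌈ρ∕2⌉+t+ρ−2})⁻¹`).
  The core-hanging stratum `H(ρ)` of B7 is the case `s = 0` (`|y″| = 1`).
CHECK (SPEC §B5 (iv)): at `q = 2`, `(ρ,t) = (1,1)`: index `1·2^0 · 1·2^0 = … = 2`? — `(q−1)q^{(1+2+1)∕2−1}·(q−1)q^{0} = 1·2·1·1 = 2`, weight `½` ✓ (oracle `(5,3,3)`, `G₁(2,2)`: 8 lattices × ½ = 4);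
`(ρ,t) = (2,1)`: `1·2^{(5)∕2−1}·1·2 = 2·2 = 4`, weight `¼` ✓; `(4,2)` : `2^{(9)∕2−1}·2^{3} = 8·8 = 64`, weight `1∕64` ✓.

HONEST LABEL.  Count-neutral (`--supports`); the census laws (MS) stay PROVER TARGETS until the Stage B assembly B10 lands; `HC_CM` is proved only modulo the 7 printed citations
(2 remaining named inputs: hLiu418 = `stmt-HodgeConjecture-24832`, h413 = `stmt-HodgeConjecture-24833`) until rung 0 closes.

## References
* [Kottwitz1986BaseChangeUnits] R. E. Kottwitz, *Base change for unit elements of Hecke algebras*, Compositio Math. 60 (1986), §1 pp. 240–241 (orbital integrals of units as weighted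
  fixed-lattice counts; the torus stabilisers).
* [Serre1979] J.-P. Serre, *Local Fields*, GTM 67 (1979), Ch. II §3, Ch. IV §2 Prop. 6 (the filtration `U ⊃ U¹ ⊃ U² ⊃ …` and its indices).
* [Serre1980Trees] J.-P. Serre, *Trees*, Springer (1980), Ch. II §1.1 (lattices, diagonal action, Hermite normal form).
-/

set_option autoImplicit false

noncomputable section

namespace Summit.HodgeConjecture.HodgeConjecture.Cruxes.H413.F0P3cDyRamDiagonalGluedStabiliserIndex

open Matrix
open Literature.NumberTheory.Automorphic Literature.NumberTheory.Automorphic.HermitianLattice Literature.NumberTheory.Automorphic.UnitaryGroup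
open Literature.NumberTheory.Automorphic.UnitaryLatticeTree
open Literature.NumberTheory.LocalFields.WildQuadraticDatum
open Summit.HodgeConjecture.HodgeConjecture.Cruxes.H413.F0P3cDyRamDiagonalTorusDefs
open Summit.HodgeConjecture.HodgeConjecture.Cruxes.H413.F0P3cDyRamDiagonalGluedFixedStabiliser
open scoped Valued WithZero Matrix MatrixGroups

variable {K : Type*} [Field K] [Valued K ℤᵐ⁰]

/-! ## §5  The two-step index -/

/-- `ϖ ≠ 0` and `|ϖ| < 1` for the datum uniformiser. [cite: Serre1979, Ch. II §3] -/
theorem ne_zero_and_v_lt_one_of_v_eq_exp {ϖ : K} (hϖ : Valued.v ϖ = WithZero.exp (-1 : ℤ)) : ϖ ≠ 0 ∧ Valued.v ϖ < 1 := by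
  refine ⟨fun h => ?_, ?_⟩
  · rw [h, map_zero] at hϖ; exact WithZero.exp_ne_zero hϖ.symm
  · rw [hϖ, ← WithZero.exp_zero, WithZero.exp_lt_exp]; norm_num

/-- `|a∕b − 1| = |b − a|` for a unit `b`. [cite: Serre1979, Ch. IV §2 Prop. 6] -/
theorem v_div_sub_one_eq {a b : K} (hb : Valued.v b = 1) : Valued.v (a / b - 1) = Valued.v (b - a) := by
  have hb0 : b ≠ 0 := fun h => by rw [h, map_zero] at hb; exact zero_ne_one hb
  rw [div_sub_one hb0, map_div₀, hb, div_one, Valuation.map_sub_swap]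

/-- **STEP 1: `[𝒰 : S₁] = (q−1)·q^{(n+1)∕2 − 1}`** for `S₁ = {u ∈ 𝒰 | u₁∕u₂ ∈ U_n}`, `n ≥ 1` (`relIndex_comap` along `u ↦ u₁∕u₂`, whose image is `U_F`, then ★ B1 (C4)
`[U_F : U_{F,n}]`). [cite: Serre1979, Ch. IV §2 Prop. 6] -/
theorem relIndex_ratioLevel_fixedUnitTorus_eq {σ : K →+* K} (hσ : ∀ a, σ (σ a) = a) (hvσ : ∀ a, Valued.v (σ a) = Valued.v a)
    (hfix : ∀ x : K, σ x = x → x ≠ 0 → ∃ n : ℤ, Valued.v x = WithZero.exp (2 * n)) {ϖ : K} (hϖ : Valued.v ϖ = WithZero.exp (-1 : ℤ))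
    {d : ℕ} (hd : Valued.v (ϖ - σ ϖ) = Valued.v ϖ ^ d) [Finite 𝓀[K]] {n : ℕ} (hn : 1 ≤ n)
    (π : (Fin 3 → Kˣ) →* Kˣ) (hπ : ∀ u, π u = u 1 / u 2)
    (Un : Subgroup Kˣ) (hUn : ∀ w : Kˣ, w ∈ Un ↔ Valued.v (w : K) = 1 ∧ Valued.v ((w : K) - 1) ≤ Valued.v ϖ ^ n) :
    (Un.comap π ⊓ fixedUnitTorus σ 3).relIndex (fixedUnitTorus σ 3) = (Nat.card 𝓀[K] - 1) * Nat.card 𝓀[K] ^ ((n + 1) / 2 - 1) := by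

  rw [Subgroup.inf_relIndex_right, Subgroup.relIndex_comap, ← Subgroup.inf_relIndex_right]
  refine relIndex_fixedUnitLevel_eq hσ hvσ hfix hϖ hd (U := (fixedUnitTorus σ 3).map π) (Un := Un ⊓ (fixedUnitTorus σ 3).map π)
    (fun w => mem_map_fixedUnitTorus_iff σ π hπ w) hn (fun w => ?_)
  rw [Subgroup.mem_inf, hUn, mem_map_fixedUnitTorus_iff σ π hπ, v_pow_eq_exp_neg hϖ]
  tauto


/-- **STEP 2: `[S₁ : S_F(latt V)] = (q−1)·q^{ρ−1}`** (`S₁` at level `ρ+s`): the twisted map `u ↦ (u₀∕u₂)·(1 + g(1 − u₁∕u₂))⁻¹` is a homomorphism `S₁ → K^×∕U_{2ρ}` (§1 defect),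
with kernel `S_F(latt V)` (§2, (c′)) and image `U_F·U_{2ρ}∕U_{2ρ}` (onto by `u = (w,1,1)`), of cardinality `[U_F : U_{F,2ρ}] = (q−1)q^{ρ−1}` (★ B1 (C4), `(2ρ+1)∕2 − 1 = ρ − 1`).
[cite: Kottwitz1986BaseChangeUnits, §1 pp. 240–241] [cite: Serre1979, Ch. IV §2 Prop. 6] -/
theorem relIndex_fixedUnitStabilizer_ratioLevel_eq {σ : K →+* K} (hσ : ∀ a, σ (σ a) = a) (hvσ : ∀ a, Valued.v (σ a) = Valued.v a)
    (hfix : ∀ x : K, σ x = x → x ≠ 0 → ∃ n : ℤ, Valued.v x = WithZero.exp (2 * n)) {ϖ : K} (hϖ : Valued.v ϖ = WithZero.exp (-1 : ℤ))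
    {d : ℕ} (hd : Valued.v (ϖ - σ ϖ) = Valued.v ϖ ^ d) [Finite 𝓀[K]] {ρ : ℕ} (hρ : 1 ≤ ρ) (s : ℕ) {x ζ y'' g : K}
    (hx : Valued.v x = 1) (hζ : Valued.v ζ = 1) (hy'' : Valued.v y'' = Valued.v ϖ ^ s) (hσg : σ g = g) (hg : Valued.v g * Valued.v ϖ ^ s ≤ 1)
    (hlin : Valued.v (x * ζ - g * y'') ≤ Valued.v ϖ ^ ρ)
    (V : GL (Fin 3) K) (hV : (V : Matrix (Fin 3) (Fin 3) K) = !![1, 0, 0; x, ϖ ^ ρ, 0; x * ζ + y'', ϖ ^ ρ * ζ, ϖ ^ (2 * ρ + s)])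
    (π : (Fin 3 → Kˣ) →* Kˣ) (hπ : ∀ u, π u = u 1 / u 2)
    (Uρs : Subgroup Kˣ) (hU : ∀ w : Kˣ, w ∈ Uρs ↔ Valued.v (w : K) = 1 ∧ Valued.v ((w : K) - 1) ≤ Valued.v ϖ ^ (ρ + s)) :
    (fixedUnitStabilizer σ (latt (V : Matrix (Fin 3) (Fin 3) K))).relIndex (Uρs.comap π ⊓ fixedUnitTorus σ 3) =
      (Nat.card 𝓀[K] - 1) * Nat.card 𝓀[K] ^ (ρ - 1) := by

  obtain ⟨hϖ0, hϖ1⟩ := ne_zero_and_v_lt_one_of_v_eq_exp hϖ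
  set T := fixedUnitTorus σ 3 with hT
  set S := fixedUnitStabilizer σ (latt (V : Matrix (Fin 3) (Fin 3) K)) with hS
  set S₁ := Uρs.comap π ⊓ T with hS₁
  -- the level-`2ρ` subgroup of `K^×`
  obtain ⟨U2, hU2⟩ := exists_unitLevel_subgroup (K := K) (Valued.v ϖ ^ (2 * ρ))
  -- membership in `S₁`, read in `K`
  have mem_S₁ : ∀ u : Fin 3 → Kˣ, u ∈ S₁ ↔
      (Valued.v ((u 1 : K) / (u 2 : K)) = 1 ∧ Valued.v ((u 1 : K) / (u 2 : K) - 1) ≤ Valued.v ϖ ^ (ρ + s)) ∧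
        (∀ i, Valued.v (u i : K) = 1) ∧ ∀ i, σ (u i) = u i := by
    intro u
    rw [hS₁, Subgroup.mem_inf, Subgroup.mem_comap, hU, hπ, Units.val_div_eq_div_val, hT, mem_fixedUnitTorus_iff]
  -- the twisted ratio `θ(u) = (u₀∕u₂)·(1 + g(1 − u₁∕u₂))⁻¹` and its properties
  have hcu : ∀ u ∈ S₁, Valued.v (g * (1 - (u 1 : K) / (u 2 : K))) ≤ Valued.v ϖ ^ ρ ∧ Valued.v (1 + g * (1 - (u 1 : K) / (u 2 : K))) = 1 :=
    fun u hu => v_one_add_mul_one_sub_eq_one hϖ1 hρ s hg ((mem_S₁ u).1 hu).1.2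
  have hval : ∀ u ∈ S₁, Valued.v (((u 0 : K) / (u 2 : K)) / (1 + g * (1 - (u 1 : K) / (u 2 : K)))) = 1 := fun u hu => by
    obtain ⟨-, hu1, -⟩ := (mem_S₁ u).1 hu
    rw [map_div₀, map_div₀, hu1 0, hu1 2, (hcu u hu).2, div_one, div_one]
  have hne : ∀ u ∈ S₁, ((u 0 : K) / (u 2 : K)) / (1 + g * (1 - (u 1 : K) / (u 2 : K))) ≠ 0 := fun u hu h => by
    have h1 := hval u hu
    rw [h, map_zero] at h1
    exact zero_ne_one h1
  have hc0 : ∀ u ∈ S₁, (1 + g * (1 - (u 1 : K) / (u 2 : K))) ≠ 0 := fun u hu h => by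
    have h1 := (hcu u hu).2
    rw [h, map_zero] at h1
    exact zero_ne_one h1
  let θ : S₁ → Kˣ := fun u => Units.mk0 _ (hne u.1 u.2)
  have hθ : ∀ u : S₁, ((θ u : Kˣ) : K) = ((u.1 0 : K) / (u.1 2 : K)) / (1 + g * (1 - (u.1 1 : K) / (u.1 2 : K))) := fun u => rfl
  -- `θ` is a homomorphism modulo `U_{2ρ}` (the defect lemma)
  have hmul : ∀ u u' : S₁, (QuotientGroup.mk' U2) (θ (u * u')) = (QuotientGroup.mk' U2) (θ u) * (QuotientGroup.mk' U2) (θ u') := by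
    intro u u'
    obtain ⟨⟨-, ha⟩, hu1, -⟩ := (mem_S₁ u.1).1 u.2
    obtain ⟨⟨-, ha'⟩, hu1', -⟩ := (mem_S₁ u'.1).1 u'.2
    have hcc := (hcu u.1 u.2).2
    have hcc' := (hcu u'.1 u'.2).2
    have hC := (hcu (u * u').1 (u * u').2).2
    have hC0 := hc0 (u * u').1 (u * u').2
    rw [← map_mul, QuotientGroup.mk'_apply, QuotientGroup.mk'_apply, QuotientGroup.eq_iff_div_mem, hU2, Units.val_div_eq_div_val, Units.val_mul,
      hθ, hθ, hθ]
    have ea : ((u * u').1 1 : K) / ((u * u').1 2 : K) = (u.1 1 : K) / (u.1 2 : K) * ((u'.1 1 : K) / (u'.1 2 : K)) := by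
      simp only [Subgroup.coe_mul, Pi.mul_apply, Units.val_mul]; rw [mul_div_mul_comm]
    have eb : ((u * u').1 0 : K) / ((u * u').1 2 : K) = (u.1 0 : K) / (u.1 2 : K) * ((u'.1 0 : K) / (u'.1 2 : K)) := by
      simp only [Subgroup.coe_mul, Pi.mul_apply, Units.val_mul]; rw [mul_div_mul_comm]
    rw [ea] at hC hC0
    rw [ea, eb]
    have hb0 : (u.1 0 : K) / (u.1 2 : K) ≠ 0 := div_ne_zero (u.1 0).ne_zero (u.1 2).ne_zero
    have hb0' : (u'.1 0 : K) / (u'.1 2 : K) ≠ 0 := div_ne_zero (u'.1 0).ne_zero (u'.1 2).ne_zero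
    have hc1 := hc0 u.1 u.2
    have hc2 := hc0 u'.1 u'.2
    have key : (u.1 0 : K) / (u.1 2 : K) * ((u'.1 0 : K) / (u'.1 2 : K)) / (1 + g * (1 - (u.1 1 : K) / (u.1 2 : K) * ((u'.1 1 : K) / (u'.1 2 : K)))) /
        ((u.1 0 : K) / (u.1 2 : K) / (1 + g * (1 - (u.1 1 : K) / (u.1 2 : K))) * ((u'.1 0 : K) / (u'.1 2 : K) / (1 + g * (1 - (u'.1 1 : K) / (u'.1 2 : K))))) =
        (1 + g * (1 - (u.1 1 : K) / (u.1 2 : K))) * (1 + g * (1 - (u'.1 1 : K) / (u'.1 2 : K))) / (1 + g * (1 - (u.1 1 : K) / (u.1 2 : K) * ((u'.1 1 : K) / (u'.1 2 : K)))) := by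
      field_simp
    rw [key]
    refine ⟨by rw [map_div₀, map_mul, hcc, hcc', hC, one_mul, div_one], ?_⟩
    rw [div_sub_one hC0, map_div₀, hC, div_one]
    exact v_defect_le hϖ1.le ρ s hg ha ha'
  let Θ : S₁ →* Kˣ ⧸ U2 := MonoidHom.mk' (fun u => (QuotientGroup.mk' U2) (θ u)) hmul
  have hΘ : ∀ u : S₁, Θ u = (QuotientGroup.mk' U2) (θ u) := fun u => rfl
  -- kernel `= S_F`
  have hker : Θ.ker = S.subgroupOf S₁ := by
    ext u
    obtain ⟨⟨ha1, ha⟩, hu1, hu2⟩ := (mem_S₁ u.1).1 u.2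
    rw [MonoidHom.mem_ker, Subgroup.mem_subgroupOf, hΘ, QuotientGroup.mk'_apply, QuotientGroup.eq_one_iff, hU2, hθ, hS,
      mem_fixedUnitStabilizer_latt_glued_iff hϖ0 hϖ1.le ρ s hx hζ hy'' hg hlin V hV ((mem_fixedUnitTorus_iff σ _).2 ⟨hu1, hu2⟩)]
    have hb : Valued.v ((u.1 2 : K) - u.1 1) ≤ Valued.v ϖ ^ (ρ + s) := by rwa [v_div_sub_one_eq (hu1 2)] at ha
    have h2 : (u.1 2 : K) ≠ 0 := (u.1 2).ne_zero
    have e1 : (u.1 0 : K) / (u.1 2 : K) - (1 + g * (1 - (u.1 1 : K) / (u.1 2 : K))) = -(g * ((u.1 2 : K) - u.1 1) + ((u.1 2 : K) - u.1 0)) / (u.1 2 : K) := by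
      field_simp
      ring
    have hv2 : Valued.v (((u.1 0 : K) / (u.1 2 : K)) / (1 + g * (1 - (u.1 1 : K) / (u.1 2 : K))) - 1) =
        Valued.v (g * ((u.1 2 : K) - u.1 1) + ((u.1 2 : K) - u.1 0)) := by
      rw [div_sub_one (hc0 u.1 u.2), map_div₀, (hcu u.1 u.2).2, div_one, e1, map_div₀, Valuation.map_neg, hu1 2, div_one]
    rw [hv2]
    exact ⟨fun h => ⟨hb, h.2⟩, fun h => ⟨hval u.1 u.2, h.2⟩⟩
  -- image `= U_F · U_{2ρ} ∕ U_{2ρ}`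
  have hrange : Θ.range = ((fixedUnitTorus σ 3).map π).map (QuotientGroup.mk' U2) := by
    ext q
    constructor
    · intro hq
      obtain ⟨u, rfl⟩ := MonoidHom.mem_range.1 hq
      obtain ⟨-, -, hu2⟩ := (mem_S₁ u.1).1 u.2
      refine Subgroup.mem_map.2 ⟨θ u, ?_, (hΘ u).symm⟩
      rw [mem_map_fixedUnitTorus_iff σ π hπ, hθ]
      exact ⟨by simp only [map_div₀, map_add, map_one, map_mul, map_sub, hσg, hu2], hval u.1 u.2⟩
    · intro hq
      obtain ⟨w, hw, rfl⟩ := Subgroup.mem_map.1 hq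
      rw [mem_map_fixedUnitTorus_iff σ π hπ] at hw
      have h10 : (1 : Fin 3) ≠ 0 := by decide
      have h20 : (2 : Fin 3) ≠ 0 := by decide
      have hu : Pi.mulSingle (0 : Fin 3) w ∈ S₁ := by
        rw [mem_S₁]
        refine ⟨?_, fun i => ?_, fun i => ?_⟩
        · rw [Pi.mulSingle_eq_of_ne h10, Pi.mulSingle_eq_of_ne h20, Units.val_one, div_one, sub_self, map_one, map_zero]
          exact ⟨rfl, zero_le⟩
        · by_cases hi : i = 0
          · subst hi; rw [Pi.mulSingle_eq_same]; exact hw.2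
          · rw [Pi.mulSingle_eq_of_ne hi, Units.val_one, map_one]
        · by_cases hi : i = 0
          · subst hi; rw [Pi.mulSingle_eq_same]; exact hw.1
          · rw [Pi.mulSingle_eq_of_ne hi, Units.val_one, map_one]
      refine ⟨⟨_, hu⟩, ?_⟩
      rw [hΘ]
      congr 1
      ext
      rw [hθ]
      simp only [Pi.mulSingle_eq_same, Pi.mulSingle_eq_of_ne h10, Pi.mulSingle_eq_of_ne h20, Units.val_one, div_one, sub_self, mul_zero, add_zero]
  -- count
  have h1 : S.relIndex S₁ = (S.subgroupOf S₁).index := rfl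
  rw [h1, ← hker, Subgroup.index_ker, hrange, ← Subgroup.relIndex_ker, QuotientGroup.ker_mk', ← Subgroup.inf_relIndex_right]
  rw [relIndex_fixedUnitLevel_eq hσ hvσ hfix hϖ hd (U := (fixedUnitTorus σ 3).map π) (Un := U2 ⊓ (fixedUnitTorus σ 3).map π)
    (fun w => mem_map_fixedUnitTorus_iff σ π hπ w) (n := 2 * ρ) (by omega)
    (fun w => by rw [Subgroup.mem_inf, hU2, mem_map_fixedUnitTorus_iff σ π hπ, v_pow_eq_exp_neg hϖ]; tauto)]
  congr 2
  omega


/-! ## §6  Heads -/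

/-- **THE GLUED STABILISER INDEX, LINEARISER FORM**: with a `σ`-fixed lineariser `g` (`|g|·|ϖ|^s ≤ 1`, `|xζ − g y″| ≤ |ϖ|^ρ`),
`[𝒰 : S_F(latt V)] = ((q−1)q^{(ρ+s+1)∕2−1})·((q−1)q^{ρ−1})`. [cite: Kottwitz1986BaseChangeUnits, §1 pp. 240–241] [cite: Serre1979, Ch. IV §2 Prop. 6] -/
theorem relIndex_fixedUnitStabilizer_latt_glued_eq_of_lineariser {σ : K →+* K} (hσ : ∀ a, σ (σ a) = a) (hvσ : ∀ a, Valued.v (σ a) = Valued.v a)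
    (hfix : ∀ x : K, σ x = x → x ≠ 0 → ∃ n : ℤ, Valued.v x = WithZero.exp (2 * n)) {ϖ : K} (hϖ : Valued.v ϖ = WithZero.exp (-1 : ℤ))
    {d : ℕ} (hd : Valued.v (ϖ - σ ϖ) = Valued.v ϖ ^ d) [Finite 𝓀[K]] {ρ : ℕ} (hρ : 1 ≤ ρ) (s : ℕ) {x ζ y'' g : K}
    (hx : Valued.v x = 1) (hζ : Valued.v ζ = 1) (hy'' : Valued.v y'' = Valued.v ϖ ^ s) (hσg : σ g = g) (hg : Valued.v g * Valued.v ϖ ^ s ≤ 1)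
    (hlin : Valued.v (x * ζ - g * y'') ≤ Valued.v ϖ ^ ρ)
    (V : GL (Fin 3) K) (hV : (V : Matrix (Fin 3) (Fin 3) K) = !![1, 0, 0; x, ϖ ^ ρ, 0; x * ζ + y'', ϖ ^ ρ * ζ, ϖ ^ (2 * ρ + s)]) :
    (fixedUnitStabilizer σ (latt (V : Matrix (Fin 3) (Fin 3) K))).relIndex (fixedUnitTorus σ 3) =
      ((Nat.card 𝓀[K] - 1) * Nat.card 𝓀[K] ^ ((ρ + s + 1) / 2 - 1)) * ((Nat.card 𝓀[K] - 1) * Nat.card 𝓀[K] ^ (ρ - 1)) := by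

  obtain ⟨hϖ0, hϖ1⟩ := ne_zero_and_v_lt_one_of_v_eq_exp hϖ
  obtain ⟨Uρs, hU⟩ := exists_unitLevel_subgroup (K := K) (Valued.v ϖ ^ (ρ + s))
  let π : (Fin 3 → Kˣ) →* Kˣ := Pi.evalMonoidHom (fun _ : Fin 3 => Kˣ) 1 / Pi.evalMonoidHom (fun _ : Fin 3 => Kˣ) 2
  have hπ : ∀ u, π u = u 1 / u 2 := fun u => rfl
  have hle : fixedUnitStabilizer σ (latt (V : Matrix (Fin 3) (Fin 3) K)) ≤ Uρs.comap π ⊓ fixedUnitTorus σ 3 := by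
    intro u hu
    have huT : u ∈ fixedUnitTorus σ 3 := (Subgroup.mem_inf.1 hu).2
    obtain ⟨hb, -⟩ := (mem_fixedUnitStabilizer_latt_glued_iff hϖ0 hϖ1.le ρ s hx hζ hy'' hg hlin V hV huT).1 hu
    obtain ⟨hu1, -⟩ := (mem_fixedUnitTorus_iff σ u).1 huT
    refine Subgroup.mem_inf.2 ⟨?_, huT⟩
    rw [Subgroup.mem_comap, hU, hπ, Units.val_div_eq_div_val, map_div₀, hu1 1, hu1 2, div_one, v_div_sub_one_eq (hu1 2)]
    exact ⟨rfl, hb⟩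
  rw [← Subgroup.relIndex_mul_relIndex _ _ _ hle inf_le_right,
    relIndex_fixedUnitStabilizer_ratioLevel_eq hσ hvσ hfix hϖ hd hρ s hx hζ hy'' hσg hg hlin V hV π hπ Uρs hU,
    relIndex_ratioLevel_fixedUnitTorus_eq hσ hvσ hfix hϖ hd (n := ρ + s) (by omega) π hπ Uρs hU, Nat.mul_comm]


/-- **HEAD — THE GLUED STABILISER INDEX UNDER (R)** (SPEC B5 (iii), general second exponent `s`; `s = 2t` on the glued tube strata, `s = 0` on the core-hanging stratum):
for the glued frame `V = (1 0 0; x ϖ^ρ 0; xζ+y″ ϖ^ρζ ϖ^{2ρ+s})` (`|x| = |ζ| = 1`, `|y″| = |ϖ|^s`, `ρ ≥ 1`) over a ramified quadratic datum, and `f = σf` with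
`|ζσy″ − σx·f| ≤ |ϖ|^{ρ+s}`:  `[𝒰 : S_F(latt V)] = ((q−1)·q^{(ρ+s+1)∕2 − 1}) · ((q−1)·q^{ρ−1})`.
[cite: Kottwitz1986BaseChangeUnits, §1 pp. 240–241] [cite: Serre1979, Ch. IV §2 Prop. 6] -/
theorem relIndex_fixedUnitStabilizer_latt_glued_eq {σ : K →+* K} (hσ : ∀ a, σ (σ a) = a) (hvσ : ∀ a, Valued.v (σ a) = Valued.v a)
    (hfix : ∀ x : K, σ x = x → x ≠ 0 → ∃ n : ℤ, Valued.v x = WithZero.exp (2 * n)) {ϖ : K} (hϖ : Valued.v ϖ = WithZero.exp (-1 : ℤ))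
    {d : ℕ} (hd : Valued.v (ϖ - σ ϖ) = Valued.v ϖ ^ d) [Finite 𝓀[K]] {ρ : ℕ} (hρ : 1 ≤ ρ) (s : ℕ) {x ζ y'' : K}
    (hx : Valued.v x = 1) (hζ : Valued.v ζ = 1) (hy'' : Valued.v y'' = Valued.v ϖ ^ s)
    (V : GL (Fin 3) K) (hV : (V : Matrix (Fin 3) (Fin 3) K) = !![1, 0, 0; x, ϖ ^ ρ, 0; x * ζ + y'', ϖ ^ ρ * ζ, ϖ ^ (2 * ρ + s)])
    {f : K} (hf : σ f = f) (hR : Valued.v (ζ * σ y'' - σ x * f) ≤ Valued.v ϖ ^ (ρ + s)) :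
    (fixedUnitStabilizer σ (latt (V : Matrix (Fin 3) (Fin 3) K))).relIndex (fixedUnitTorus σ 3) =
      ((Nat.card 𝓀[K] - 1) * Nat.card 𝓀[K] ^ ((ρ + s + 1) / 2 - 1)) * ((Nat.card 𝓀[K] - 1) * Nat.card 𝓀[K] ^ (ρ - 1)) := by

  obtain ⟨hϖ0, hϖ1⟩ := ne_zero_and_v_lt_one_of_v_eq_exp hϖ
  obtain ⟨-, hσg, hg, hlin⟩ := lineariser_of_criterionR hσ hvσ hϖ0 hϖ1 hρ s hx hζ hy'' hf hR
  exact relIndex_fixedUnitStabilizer_latt_glued_eq_of_lineariser hσ hvσ hfix hϖ hd hρ s hx hζ hy'' hσg hg.le hlin V hV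


/-- **THE WEIGHT OF A DUALISABLE GLUED LATTICE**: `stabiliserWeight σ (latt V) = (((q−1)q^{(ρ+s+1)∕2−1})·((q−1)q^{ρ−1}))⁻¹` (★ DEFS LEAF: the weight is the inverse index, cast to `ℚ`).
[cite: Kottwitz1986BaseChangeUnits, §1 pp. 240–241] -/
theorem stabiliserWeight_latt_glued_eq {σ : K →+* K} (hσ : ∀ a, σ (σ a) = a) (hvσ : ∀ a, Valued.v (σ a) = Valued.v a)
    (hfix : ∀ x : K, σ x = x → x ≠ 0 → ∃ n : ℤ, Valued.v x = WithZero.exp (2 * n)) {ϖ : K} (hϖ : Valued.v ϖ = WithZero.exp (-1 : ℤ))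
    {d : ℕ} (hd : Valued.v (ϖ - σ ϖ) = Valued.v ϖ ^ d) [Finite 𝓀[K]] {ρ : ℕ} (hρ : 1 ≤ ρ) (s : ℕ) {x ζ y'' : K}
    (hx : Valued.v x = 1) (hζ : Valued.v ζ = 1) (hy'' : Valued.v y'' = Valued.v ϖ ^ s)
    (V : GL (Fin 3) K) (hV : (V : Matrix (Fin 3) (Fin 3) K) = !![1, 0, 0; x, ϖ ^ ρ, 0; x * ζ + y'', ϖ ^ ρ * ζ, ϖ ^ (2 * ρ + s)])
    {f : K} (hf : σ f = f) (hR : Valued.v (ζ * σ y'' - σ x * f) ≤ Valued.v ϖ ^ (ρ + s)) :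
    stabiliserWeight σ (latt (V : Matrix (Fin 3) (Fin 3) K)) =
      ((((Nat.card 𝓀[K] - 1) * Nat.card 𝓀[K] ^ ((ρ + s + 1) / 2 - 1)) * ((Nat.card 𝓀[K] - 1) * Nat.card 𝓀[K] ^ (ρ - 1)) : ℕ) : ℚ)⁻¹ := by

  unfold stabiliserWeight
  rw [relIndex_fixedUnitStabilizer_latt_glued_eq hσ hvσ hfix hϖ hd hρ s hx hζ hy'' V hV hf hR]


/-- **B5 (iii) «GLUED STABILISER INDEX» (SPEC v2-B5split §B5 (iii), letters of ★ B5 (i) p855737: `s = 2t`)**: on the glued tube stratum `G₁(2ρ, 2t)`, under (R),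
`[𝒰 : S_F(latt V)] = ((q−1)·q^{(ρ+2t+1)∕2 − 1}) · ((q−1)·q^{ρ−1})`. [cite: Kottwitz1986BaseChangeUnits, §1 pp. 240–241] [cite: Serre1979, Ch. IV §2 Prop. 6] -/
theorem relIndex_fixedUnitStabilizer_latt_glued_tube_eq {σ : K →+* K} (hσ : ∀ a, σ (σ a) = a) (hvσ : ∀ a, Valued.v (σ a) = Valued.v a)
    (hfix : ∀ x : K, σ x = x → x ≠ 0 → ∃ n : ℤ, Valued.v x = WithZero.exp (2 * n)) {ϖ : K} (hϖ : Valued.v ϖ = WithZero.exp (-1 : ℤ))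
    {d : ℕ} (hd : Valued.v (ϖ - σ ϖ) = Valued.v ϖ ^ d) [Finite 𝓀[K]] {ρ : ℕ} (hρ : 1 ≤ ρ) (t : ℕ) {x ζ y'' : K}
    (hx : Valued.v x = 1) (hζ : Valued.v ζ = 1) (hy'' : Valued.v y'' = Valued.v ϖ ^ (2 * t))
    (V : GL (Fin 3) K) (hV : (V : Matrix (Fin 3) (Fin 3) K) = !![1, 0, 0; x, ϖ ^ ρ, 0; x * ζ + y'', ϖ ^ ρ * ζ, ϖ ^ (2 * ρ + 2 * t)])
    {f : K} (hf : σ f = f) (hR : Valued.v (ζ * σ y'' - σ x * f) ≤ Valued.v ϖ ^ (ρ + 2 * t)) :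
    (fixedUnitStabilizer σ (latt (V : Matrix (Fin 3) (Fin 3) K))).relIndex (fixedUnitTorus σ 3) =
      ((Nat.card 𝓀[K] - 1) * Nat.card 𝓀[K] ^ ((ρ + 2 * t + 1) / 2 - 1)) * ((Nat.card 𝓀[K] - 1) * Nat.card 𝓀[K] ^ (ρ - 1)) :=
  relIndex_fixedUnitStabilizer_latt_glued_eq hσ hvσ hfix hϖ hd hρ (2 * t) hx hζ hy'' V hV hf hR

/-- **B5 (iii), THE WEIGHT on the glued tube stratum**: `stabiliserWeight σ (latt V) = ((q−1)² · q^{(ρ+2t+1)∕2 + ρ − 2})⁻¹`, printed as the inverse of the product of §5.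
[cite: Kottwitz1986BaseChangeUnits, §1 pp. 240–241] -/
theorem stabiliserWeight_latt_glued_tube_eq {σ : K →+* K} (hσ : ∀ a, σ (σ a) = a) (hvσ : ∀ a, Valued.v (σ a) = Valued.v a)
    (hfix : ∀ x : K, σ x = x → x ≠ 0 → ∃ n : ℤ, Valued.v x = WithZero.exp (2 * n)) {ϖ : K} (hϖ : Valued.v ϖ = WithZero.exp (-1 : ℤ))
    {d : ℕ} (hd : Valued.v (ϖ - σ ϖ) = Valued.v ϖ ^ d) [Finite 𝓀[K]] {ρ : ℕ} (hρ : 1 ≤ ρ) (t : ℕ) {x ζ y'' : K}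
    (hx : Valued.v x = 1) (hζ : Valued.v ζ = 1) (hy'' : Valued.v y'' = Valued.v ϖ ^ (2 * t))
    (V : GL (Fin 3) K) (hV : (V : Matrix (Fin 3) (Fin 3) K) = !![1, 0, 0; x, ϖ ^ ρ, 0; x * ζ + y'', ϖ ^ ρ * ζ, ϖ ^ (2 * ρ + 2 * t)])
    {f : K} (hf : σ f = f) (hR : Valued.v (ζ * σ y'' - σ x * f) ≤ Valued.v ϖ ^ (ρ + 2 * t)) :
    stabiliserWeight σ (latt (V : Matrix (Fin 3) (Fin 3) K)) =
      ((((Nat.card 𝓀[K] - 1) * Nat.card 𝓀[K] ^ ((ρ + 2 * t + 1) / 2 - 1)) * ((Nat.card 𝓀[K] - 1) * Nat.card 𝓀[K] ^ (ρ - 1)) : ℕ) : ℚ)⁻¹ :=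
  stabiliserWeight_latt_glued_eq hσ hvσ hfix hϖ hd hρ (2 * t) hx hζ hy'' V hV hf hR

/-! ## §7  ED. 2 (append-only): the core-hanging stratum `H(ρ)` — the case `s = 0` in the letters of ★ B7 (i) p855897 -/

/-- **B7 (iii) «CORE-HANGING STABILISER INDEX» (the `s = 0` end of the glued family, letters of ★ B7 (i) `F0P3cDyRamDiagonalCoreHangingCriterion`: frame
`V = (1 0 0; x ϖ^ρ 0; xζ+y″ ϖ^ρζ ϖ^{2ρ})`, `|x| = |ζ| = |y″| = 1`, `ρ ≥ 1`, (R) at level `ρ`)**: `[𝒰 : S_F(latt V)] = ((q−1)·q^{(ρ+1)∕2 − 1}) · ((q−1)·q^{ρ−1})`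
(the stratum's extra unit letter `|xζ + y″| = 1` is not needed for the stabiliser). [cite: Kottwitz1986BaseChangeUnits, §1 pp. 240–241] [cite: Serre1979, Ch. IV §2 Prop. 6] -/
theorem relIndex_fixedUnitStabilizer_latt_coreHanging_eq {σ : K →+* K} (hσ : ∀ a, σ (σ a) = a) (hvσ : ∀ a, Valued.v (σ a) = Valued.v a)
    (hfix : ∀ x : K, σ x = x → x ≠ 0 → ∃ n : ℤ, Valued.v x = WithZero.exp (2 * n)) {ϖ : K} (hϖ : Valued.v ϖ = WithZero.exp (-1 : ℤ))
    {d : ℕ} (hd : Valued.v (ϖ - σ ϖ) = Valued.v ϖ ^ d) [Finite 𝓀[K]] {ρ : ℕ} (hρ : 1 ≤ ρ) {x ζ y'' : K}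
    (hx : Valued.v x = 1) (hζ : Valued.v ζ = 1) (hy'' : Valued.v y'' = 1)
    (V : GL (Fin 3) K) (hV : (V : Matrix (Fin 3) (Fin 3) K) = !![1, 0, 0; x, ϖ ^ ρ, 0; x * ζ + y'', ϖ ^ ρ * ζ, ϖ ^ (2 * ρ)])
    {f : K} (hf : σ f = f) (hR : Valued.v (ζ * σ y'' - σ x * f) ≤ Valued.v ϖ ^ ρ) :
    (fixedUnitStabilizer σ (latt (V : Matrix (Fin 3) (Fin 3) K))).relIndex (fixedUnitTorus σ 3) =
      ((Nat.card 𝓀[K] - 1) * Nat.card 𝓀[K] ^ ((ρ + 1) / 2 - 1)) * ((Nat.card 𝓀[K] - 1) * Nat.card 𝓀[K] ^ (ρ - 1)) := by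
  have hV0 : (V : Matrix (Fin 3) (Fin 3) K) = !![1, 0, 0; x, ϖ ^ ρ, 0; x * ζ + y'', ϖ ^ ρ * ζ, ϖ ^ (2 * ρ + 0)] := by
    rw [Nat.add_zero]; exact hV
  have h := relIndex_fixedUnitStabilizer_latt_glued_eq hσ hvσ hfix hϖ hd hρ 0 hx hζ (by rw [pow_zero]; exact hy'') V hV0 hf
    (by rw [Nat.add_zero]; exact hR)
  rw [Nat.add_zero] at h
  exact h

/-- **B7 (iii), THE WEIGHT on the core-hanging stratum**: `stabiliserWeight σ (latt V) = (((q−1)q^{(ρ+1)∕2−1})·((q−1)q^{ρ−1}))⁻¹ = ((q−1)²·q^{⌈ρ∕2⌉+ρ−2})⁻¹`.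
[cite: Kottwitz1986BaseChangeUnits, §1 pp. 240–241] -/
theorem stabiliserWeight_latt_coreHanging_eq {σ : K →+* K} (hσ : ∀ a, σ (σ a) = a) (hvσ : ∀ a, Valued.v (σ a) = Valued.v a)
    (hfix : ∀ x : K, σ x = x → x ≠ 0 → ∃ n : ℤ, Valued.v x = WithZero.exp (2 * n)) {ϖ : K} (hϖ : Valued.v ϖ = WithZero.exp (-1 : ℤ))
    {d : ℕ} (hd : Valued.v (ϖ - σ ϖ) = Valued.v ϖ ^ d) [Finite 𝓀[K]] {ρ : ℕ} (hρ : 1 ≤ ρ) {x ζ y'' : K}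
    (hx : Valued.v x = 1) (hζ : Valued.v ζ = 1) (hy'' : Valued.v y'' = 1)
    (V : GL (Fin 3) K) (hV : (V : Matrix (Fin 3) (Fin 3) K) = !![1, 0, 0; x, ϖ ^ ρ, 0; x * ζ + y'', ϖ ^ ρ * ζ, ϖ ^ (2 * ρ)])
    {f : K} (hf : σ f = f) (hR : Valued.v (ζ * σ y'' - σ x * f) ≤ Valued.v ϖ ^ ρ) :
    stabiliserWeight σ (latt (V : Matrix (Fin 3) (Fin 3) K)) =
      ((((Nat.card 𝓀[K] - 1) * Nat.card 𝓀[K] ^ ((ρ + 1) / 2 - 1)) * ((Nat.card 𝓀[K] - 1) * Nat.card 𝓀[K] ^ (ρ - 1)) : ℕ) : ℚ)⁻¹ := by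
  unfold stabiliserWeight
  rw [relIndex_fixedUnitStabilizer_latt_coreHanging_eq hσ hvσ hfix hϖ hd hρ hx hζ hy'' V hV hf hR]

/-- **THE INDEX IN CLOSED FORM** (for consumers who multiply counts by weights): for `ρ ≥ 1` (any `q`),
`((q−1)·q^{(ρ+s+1)∕2 − 1})·((q−1)·q^{ρ−1}) = (q−1)^2 · q^{(ρ+s+1)∕2 + ρ − 2}` in `ℕ`. [cite: Serre1979, Ch. IV §2 Prop. 6] -/
theorem index_product_eq_sq_mul_pow (q : ℕ) {ρ : ℕ} (hρ : 1 ≤ ρ) (s : ℕ) :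
    ((q - 1) * q ^ ((ρ + s + 1) / 2 - 1)) * ((q - 1) * q ^ (ρ - 1)) = (q - 1) ^ 2 * q ^ ((ρ + s + 1) / 2 + ρ - 2) := by
  have h1 : 1 ≤ (ρ + s + 1) / 2 := by omega
  have e : (ρ + s + 1) / 2 + ρ - 2 = ((ρ + s + 1) / 2 - 1) + (ρ - 1) := by omega
  rw [e, pow_add, sq]
  ring

end Summit.HodgeConjecture.HodgeConjecture.Cruxes.H413.F0P3cDyRamDiagonalGluedStabiliserIndex

end
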